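import Summits.ValiantsHypothesis.ValiantsHypothesis.Theorems.DivisionGapZeroOneTransferSignedSpan
import Summits.ValiantsHypothesis.ValiantsHypothesis.Theorems.DivisionGapZeroOneTransferSpanReduction

/-!
# `ZeroOneTransfer` from the WEAKEST sign-elimination bet of line `arborescence-span`

Support file for crux `stmt-ValiantsHypothesis-5066` (`ZeroOneTransfer`, H2 of route DivisionGap),
line `arborescence-span` (continuation lead, 2026-08-16).

The registered bet of the line is S2 (`stub_signElimination`: Kirchhoff sign elimination with a
Kirchhoff OUTPUT form `f · ΣA'_i = ΣB'_j` over `ST_{N'}`, `N', I, J` quasi-polynomial in `N`), and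
the tree's `stub_spanReduction` (`Theorems/DivisionGapZeroOneTransferSpanReduction.lean`) shows
S2 ⇒ `ZeroOneTransfer`.  This file records, kernel-checked, that the crux already follows from the
weaker bet S2'' (`SignEliminationWeak`, the inline hypothesis of
`stub_weakReduction`), which keeps the Kirchhoff INPUT form — a signed
representation `f · A + C = B` by positive projections of `ST_N`, `A ≠ 0`, `f` with 0/1
coefficients — but asks only for SOME division certificate `f · h = g`, `h ≠ 0`, of size
quasi-polynomial in `N`: no Kirchhoff output form and hence no cofactor-degree clause.
S2 ⇒ S2'' is the tree's closure calculus (`SpanReduction.divComplexity_le_of_span`: projection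
closure, `StDivisionEasy`, sum and quotient closure); S2'' ⇒ `ZeroOneTransfer` is S1
(`stub_signedSpan`) plus one quasi-polynomial absorption (`stub_weakReduction` below, a stub
registered on the crux item for this purpose).  Conversely `ZeroOneTransfer` gives S2'' instance-wise on every `VP_ℂ` family of
Kirchhoff-presented 0/1 polynomials, so S2'' is the crux made finitary and uniform in the
presentation size `N` — the statement to promote if the Kirchhoff output form of S2 is not wanted.
-/

noncomputable section

-- Sub = Summit single-conjunct layout: the duplicated namespace component is mandated by the tree.
set_option linter.dupNamespace false

namespace Summit.ValiantsHypothesis.ValiantsHypothesis.Theorems.DivisionGapZeroOneTransfer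

open Literature.Computability.AlgebraicComplexity Literature.Barriers.ValiantsHypothesis
open MvPolynomial Finset
open scoped NNReal

namespace WeakReduction

/-- Composition of two quasi-polynomial scales is quasi-polynomial: for all `c₁ c₂` there is `c`
with `2 ^ ((log₂ (2 ^ ((log₂ n + c₁) ^ c₁)) + c₂) ^ c₂) ≤ 2 ^ ((log₂ n + c) ^ c)` for every `n`
(the case `a = k = 1` of the tree's `SpanReduction.exists_qp_absorb`, reproved here so that this
file does not depend on that module). [folklore] -/
theorem qp_compose (c₁ c₂ : ℕ) : ∃ c : ℕ, ∀ n : ℕ,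
    (2 : ℕ) ^ ((Nat.log 2 (2 ^ ((Nat.log 2 n + c₁) ^ c₁)) + c₂) ^ c₂) ≤
      2 ^ ((Nat.log 2 n + c) ^ c) := by
  refine ⟨(c₁ + 1) * c₂ + c₁ + c₂ + 2, fun n => ?_⟩
  set P := (c₁ + 1) * c₂ with hP
  set c := P + c₁ + c₂ + 2 with hc
  set L := Nat.log 2 n with hL
  set M := L + c with hM
  have hM1 : 1 ≤ M := by omega
  rw [Nat.log_pow (by norm_num : 1 < 2)]
  apply Nat.pow_le_pow_right two_pos
  have h2 : (L + c₁) ^ c₁ + c₂ ≤ M ^ (c₁ + 1) := by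
    have h1 : (L + c₁) ^ c₁ ≤ M ^ c₁ := Nat.pow_le_pow_left (by omega) _
    have hMc1 : 1 ≤ M ^ c₁ := Nat.one_le_pow _ _ hM1
    calc (L + c₁) ^ c₁ + c₂ ≤ M ^ c₁ + c₂ * M ^ c₁ := by nlinarith
      _ = (1 + c₂) * M ^ c₁ := by ring
      _ ≤ M * M ^ c₁ := Nat.mul_le_mul_right _ (by omega)
      _ = M ^ (c₁ + 1) := by ring
  calc ((L + c₁) ^ c₁ + c₂) ^ c₂ ≤ (M ^ (c₁ + 1)) ^ c₂ := Nat.pow_le_pow_left h2 _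
    _ = M ^ P := by rw [← pow_mul]
    _ ≤ M ^ c := Nat.pow_le_pow_right hM1 (by omega)

end WeakReduction

/-- **stub `stub_weakReduction` — S2'' ⇒ `ZeroOneTransfer`** (registered on the crux item by the
continuation lead).  The hypothesis is S2'' (`SignEliminationWeak`, stated inline):
ONE constant `c` such that every 0/1-coefficient `f` with a signed Kirchhoff representation
`f · A + C = B` (`A, B, C` positive projections of `ST_N`, `A ≠ 0`) has a division certificate of
size quasi-polynomial in `N` — some `h ≠ 0` with `L(f · h) + L(h) ≤ 2 ^ ((log₂ N + c) ^ c)`, `L`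
the fan-in-two circuit size over the semiring `ℝ≥0`.  Proof: given a 0/1 family `f` over `ℝ≥0`
with complexification in `VP_ℂ`, S1 (`stub_signedSpan`) presents `f_n` by a signed Kirchhoff
representation over `ST_N` with `N ≤ 2 ^ ((log₂ n + c₁) ^ c₁)`; S2'' yields a certificate of size
`2 ^ ((log₂ N + c₂) ^ c₂)`, and one quasi-polynomial in `n` absorbs the composition
(`WeakReduction.qp_compose`). [folklore] -/
theorem stub_weakReduction :
    (∃ c : ℕ, ∀ (N : ℕ) (τ : Type) [Fintype τ] (f : MvPolynomial τ NNReal),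
      (∀ m, MvPolynomial.coeff m f = 0 ∨ MvPolynomial.coeff m f = 1) →
      ∀ A B C : MvPolynomial τ NNReal,
        Literature.Computability.AlgebraicComplexity.IsProjection A
            (Literature.Barriers.ValiantsHypothesis.stPoly NNReal N) →
        Literature.Computability.AlgebraicComplexity.IsProjection B
            (Literature.Barriers.ValiantsHypothesis.stPoly NNReal N) →
        Literature.Computability.AlgebraicComplexity.IsProjection C
            (Literature.Barriers.ValiantsHypothesis.stPoly NNReal N) →
        A ≠ 0 → f * A + C = B →
        ∃ h : MvPolynomial τ NNReal, h ≠ 0 ∧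
          Literature.Computability.AlgebraicComplexity.complexity (f * h) +
              Literature.Computability.AlgebraicComplexity.complexity h ≤
            2 ^ ((Nat.log 2 N + c) ^ c)) →
    Summit.ValiantsHypothesis.ValiantsHypothesis.Theses.DivisionGap.ZeroOneTransfer := by
  intro hW
  obtain ⟨c₂, hc₂⟩ := hW
  intro σ _ f h01 hVP
  obtain ⟨c₁, hc₁⟩ := stub_signedSpan σ f hVP
  obtain ⟨c, hc⟩ := WeakReduction.qp_compose c₁ c₂
  refine ⟨c, fun n => ?_⟩
  obtain ⟨N, hN, A, B, C, hA, hB, hC, hA0, hABC⟩ := hc₁ n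
  obtain ⟨h, hne, hle⟩ := hc₂ N (σ n) (f n) (h01 n) A B C hA hB hC hA0 hABC
  refine ⟨h, hne, hle.trans (le_trans ?_ (hc n))⟩
  exact Nat.pow_le_pow_right two_pos
    (Nat.pow_le_pow_left (Nat.add_le_add_right (Nat.log_mono_right hN) c₂) c₂)

/-- **S2 ⇒ S2''**: a Kirchhoff output form `f · ΣA'_i = ΣB'_j` over `ST_{N'}` with
`N', I, J ≤ 2 ^ ((log₂ N + c) ^ c)` (the registered bet `stub_signElimination` of line
`arborescence-span`, stated inline as the hypothesis) is in particular a quasi-polynomial division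
certificate (S2'', stated inline as the conclusion), by the tree's closure calculus
`SpanReduction.divComplexity_le_of_span` (projection closure, `StDivisionEasy`, sum and quotient
closure) at the scale `n := N` and attainment of `divComplexity` by a nonzero cofactor. [folklore] -/
theorem signEliminationWeak_of_signElimination
    (hS2 : ∃ c : ℕ, ∀ (N : ℕ) (τ : Type) [Fintype τ] (f : MvPolynomial τ NNReal),
      (∀ m, MvPolynomial.coeff m f = 0 ∨ MvPolynomial.coeff m f = 1) →
      ∀ A B C : MvPolynomial τ NNReal,
        IsProjection A (stPoly NNReal N) → IsProjection B (stPoly NNReal N) →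
        IsProjection C (stPoly NNReal N) → A ≠ 0 → f * A + C = B →
        ∃ N' ≤ 2 ^ ((Nat.log 2 N + c) ^ c), ∃ I ≤ 2 ^ ((Nat.log 2 N + c) ^ c),
          ∃ J ≤ 2 ^ ((Nat.log 2 N + c) ^ c),
          ∃ (A' : Fin I → MvPolynomial τ NNReal) (B' : Fin J → MvPolynomial τ NNReal),
            (∀ i, IsProjection (A' i) (stPoly NNReal N')) ∧
            (∀ j, IsProjection (B' j) (stPoly NNReal N')) ∧
            (∑ i, A' i) ≠ 0 ∧ f * ∑ i, A' i = ∑ j, B' j) :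
    ∃ c : ℕ, ∀ (N : ℕ) (τ : Type) [Fintype τ] (f : MvPolynomial τ NNReal),
      (∀ m, MvPolynomial.coeff m f = 0 ∨ MvPolynomial.coeff m f = 1) →
      ∀ A B C : MvPolynomial τ NNReal,
        IsProjection A (stPoly NNReal N) → IsProjection B (stPoly NNReal N) →
        IsProjection C (stPoly NNReal N) → A ≠ 0 → f * A + C = B →
        ∃ h : MvPolynomial τ NNReal, h ≠ 0 ∧
          complexity (f * h) + complexity h ≤ 2 ^ ((Nat.log 2 N + c) ^ c) := by
  classical
  obtain ⟨c₂, hc₂⟩ := hS2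
  obtain ⟨c, hc⟩ := SpanReduction.divComplexity_le_of_span c₂
  refine ⟨c, fun N τ _ f h01 A B C hA hB hC hA0 hABC => ?_⟩
  obtain ⟨N', hN', I, hI, J, hJ, A', B', hA', hB', hA'0, hEq⟩ :=
    hc₂ N τ f h01 A B C hA hB hC hA0 hABC
  have hdiv := hc N τ f N' I J A' B' hN' hI hJ hA' hB' hA'0 hEq
  obtain ⟨h, hne, heq⟩ :=
    Summit.ValiantsHypothesis.ValiantsHypothesis.Theorems.ZeroOneTransfer.Negative.exists_eq_divComplexity f
  exact ⟨h, hne, heq ▸ hdiv⟩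

end Summit.ValiantsHypothesis.ValiantsHypothesis.Theorems.DivisionGapZeroOneTransfer

end
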